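import Summits.NavierStokesRegularity.NavierStokesRegularity.Theorems.OddMorawetzDefs
import Literature.Analysis.FluidPDE.TaoAveragedEulerProofs
import Literature.Analysis.FluidPDE.EulerBilinearSymbol
import Literature.Analysis.FluidPDE.TaoAveragedEulerContDiff

/-!
# Route OddMorawetz / `OrderThreeIndefinite` — duality for the Leray projector and integration by parts

Support file for item stmt-NavierStokesRegularity-1379: the general (field-independent) analysis that turns the
order-3 Euler-derivative form
`Q_R(v) = -∫ (⟪curl b, Dv ω⟫ + ⟪ω, Db ω⟫ + ⟪ω, Dv curl b⟫)`, `b = B(v,v) = -½ P[2(v·∇)v]`, `ω = curl v`,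
of a divergence-free Schwartz field into explicit pairings:
* **duality for the function-level Leray projector** of the tree (`lerayProjFun`, `leraySymbolC`,
  `TaoAveragedEuler.lean`): for Schwartz `W, G` on `ℝ³`,
  `∫ ⟪P W, G⟫ = ∫ ⟪W, G⟫ − (4π²)⁻¹ Re ∫ 𝓕(div W_ℂ) conj(𝓕(div G_ℂ)) / |ξ|² dξ`
  (the tree's `integral_inner_fourierInv_eq`, `fourier_divSchwartz_apply`, Mathlib's Plancherel
  `SchwartzMap.integral_inner_fourier_fourier`);
* **integration by parts** of `∂ⱼ B(v,v)` against Schwartz test fields (`B(v,v)` is smooth with `L²` derivatives,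
  the tree's `contDiff_eulerBilinear_holds`; Mathlib's `integral_bilinear_hasFDerivAt_right_eq_neg_left_of_integrable`);
* the **pointwise algebra** `⟪curl b, A ω⟫ + ⟪ω, (Db) ω⟫ + ⟪ω, A curl b⟫ = ∑ⱼ ⟪∂ⱼ b, Ψⱼ(A, ω)⟫` with the test vectors
  `psiVec` of `OddMorawetzDefs`, and the assembly `Q_R(v) = ∫ ⟪b, ∑ⱼ ∂ⱼ Ψⱼ⟫ = -½ ∫ ⟪P W, G⟫`.
Everything is proved; no definitions.
-/

noncomputable section

open MeasureTheory SchwartzMap MvPolynomial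
open scoped RealInnerProductSpace LineDeriv

-- the problem namespace `Summit.NavierStokesRegularity.NavierStokesRegularity` repeats the summit name by design (D-0017)
set_option linter.dupNamespace false

namespace Summit.NavierStokesRegularity.NavierStokesRegularity.Theorems.OddMorawetz

/-! ### Duality: `∫⟪P W, G⟫ = ∫⟪W, G⟫ − (4π²)⁻¹ Re ∫ 𝓕(div W) conj(𝓕(div G)) / |ξ|²` -/

section Duality
open FourierTransform Complex Literature.Analysis Literature.Analysis.FluidPDE
open scoped ComplexConjugate InnerProductSpace

/-- The Leray symbol paired: `⟪a, P̂(ξ) b⟫ = ⟪a, b⟫ − (ξ·b) conj(ξ·a) / |ξ|²`. -/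
theorem inner_leraySymbolC_eq (ξ : E3) (a b : EuclideanSpace ℂ (Fin 3)) :
    ⟪a, leraySymbolC ξ b⟫_ℂ = ⟪a, b⟫_ℂ -
      (∑ i, (ξ i : ℂ) * b i) * conj (∑ i, (ξ i : ℂ) * a i) / ((‖ξ‖ ^ 2 : ℝ) : ℂ) := by
  have h : ⟪a, FunctionSpaces.EuclideanSpace.complexify ξ⟫_ℂ = conj (∑ i, (ξ i : ℂ) * a i) := by
    simp [PiLp.inner_apply, map_sum]
  simp only [leraySymbolC, inner_sub_right, inner_smul_right, h]
  ring

/-- **Duality for the Leray projector** on Schwartz fields of `ℝ³`: with `Ŵ = 𝓕(W_ℂ)`, `Ĝ = 𝓕(G_ℂ)` and the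
complex divergences `ρ_W = ∑ᵢ ∂ᵢ (W_ℂ)ᵢ`, `ρ_G`,
`∫ ⟪P W, G⟫ = ∫ ⟪W, G⟫ − (4π²)⁻¹ Re ∫ 𝓕ρ_W(ξ) conj(𝓕ρ_G(ξ)) / |ξ|² dξ`. -/
theorem integral_inner_lerayProjFun_eq_sub (W G : 𝓢(E3, E3))
    (ρW ρG : 𝓢(E3, ℂ))
    (hρW : ρW = ∑ i, (∂_{EuclideanSpace.single i (1 : ℝ)}
      (SchwartzMap.postcompCLM ((EuclideanSpace.proj i : EuclideanSpace ℂ (Fin 3) →L[ℂ] ℂ).restrictScalars ℝ)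
        (SchwartzMap.postcompCLM (𝕜 := ℝ) FunctionSpaces.EuclideanSpace.complexify.toContinuousLinearMap W)) :
        𝓢(E3, ℂ)))
    (hρG : ρG = ∑ i, (∂_{EuclideanSpace.single i (1 : ℝ)}
      (SchwartzMap.postcompCLM ((EuclideanSpace.proj i : EuclideanSpace ℂ (Fin 3) →L[ℂ] ℂ).restrictScalars ℝ)
        (SchwartzMap.postcompCLM (𝕜 := ℝ) FunctionSpaces.EuclideanSpace.complexify.toContinuousLinearMap G)) :
        𝓢(E3, ℂ))) :
    ∫ x, ⟪lerayProjFun (⇑W) x, G x⟫ = (∫ x, ⟪W x, G x⟫) -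
      ((2 * Real.pi) ^ 2)⁻¹ * RCLike.re (∫ ξ : E3, 𝓕 (⇑ρW) ξ * conj (𝓕 (⇑ρG) ξ) / ((‖ξ‖ ^ 2 : ℝ) : ℂ)) := by
  set cW : 𝓢(E3, EuclideanSpace ℂ (Fin 3)) :=
    SchwartzMap.postcompCLM (𝕜 := ℝ) FunctionSpaces.EuclideanSpace.complexify.toContinuousLinearMap W with hcWdef
  set cG : 𝓢(E3, EuclideanSpace ℂ (Fin 3)) :=
    SchwartzMap.postcompCLM (𝕜 := ℝ) FunctionSpaces.EuclideanSpace.complexify.toContinuousLinearMap G with hcGdef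
  set FW : 𝓢(E3, EuclideanSpace ℂ (Fin 3)) := 𝓕 cW with hFWdef
  set FG : 𝓢(E3, EuclideanSpace ℂ (Fin 3)) := 𝓕 cG with hFGdef
  have hcW : (⇑cW : E3 → EuclideanSpace ℂ (Fin 3)) = FunctionSpaces.EuclideanSpace.complexify ∘ ⇑W := rfl
  have hcG : (⇑cG : E3 → EuclideanSpace ℂ (Fin 3)) = FunctionSpaces.EuclideanSpace.complexify ∘ ⇑G := rfl
  have hFWc : (⇑FW : E3 → EuclideanSpace ℂ (Fin 3)) = 𝓕 (⇑cW) := SchwartzMap.fourier_coe cW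
  have hFGc : (⇑FG : E3 → EuclideanSpace ℂ (Fin 3)) = 𝓕 (⇑cG) := SchwartzMap.fourier_coe cG
  have hGi : Integrable (FunctionSpaces.EuclideanSpace.complexify ∘ ⇑G) := by rw [← hcG]; exact cG.integrable
  have hGc : Continuous (FunctionSpaces.EuclideanSpace.complexify ∘ ⇑G) := by rw [← hcG]; exact cG.continuous
  have hFW : fourierVec (⇑W) = 𝓕 (⇑cW) := by rw [hcW]; rfl
  have hFG : 𝓕 (FunctionSpaces.EuclideanSpace.complexify ∘ ⇑G) = ⇑FG := by rw [hFGc, hcG]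
  have hcWi : Integrable (𝓕 (⇑cW)) volume := by rw [← hFWc]; exact FW.integrable
  have hcWc : Continuous (𝓕 (⇑cW)) := by rw [← hFWc]; exact FW.continuous
  -- the multiplier output is integrable
  have hPi : Integrable (fun ξ => leraySymbolC ξ (fourierVec (⇑W) ξ)) := by
    rw [hFW]
    refine Integrable.mono' (hcWi.norm.const_mul 2)
      (measurable_leraySymbolC_comp hcWc).aestronglyMeasurable ?_
    exact Filter.Eventually.of_forall fun ξ => norm_leraySymbolC_le ξ _
  -- Step 1: to the Fourier side
  have step1 : ∫ x, ⟪lerayProjFun (⇑W) x, G x⟫ =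
      RCLike.re (∫ ξ, ⟪FG ξ, leraySymbolC ξ (FW ξ)⟫_ℂ) := by
    calc ∫ x, ⟪lerayProjFun (⇑W) x, G x⟫
        = ∫ x, RCLike.re ⟪(FunctionSpaces.EuclideanSpace.complexify ∘ ⇑G) x,
            𝓕⁻ (fun ξ => leraySymbolC ξ (fourierVec (⇑W) ξ)) x⟫_ℂ :=
          integral_congr_ae (Filter.Eventually.of_forall fun x => inner_realPart_eq_re_inner _ _)
      _ = RCLike.re (∫ x, ⟪(FunctionSpaces.EuclideanSpace.complexify ∘ ⇑G) x,
            𝓕⁻ (fun ξ => leraySymbolC ξ (fourierVec (⇑W) ξ)) x⟫_ℂ) :=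
          integral_re (integrable_inner_fourierInv hGi hGc hPi)
      _ = RCLike.re (∫ ξ, ⟪𝓕 (FunctionSpaces.EuclideanSpace.complexify ∘ ⇑G) ξ,
            leraySymbolC ξ (fourierVec (⇑W) ξ)⟫_ℂ) := by
          rw [integral_inner_fourierInv_eq hGi hPi]
      _ = RCLike.re (∫ ξ, ⟪FG ξ, leraySymbolC ξ (FW ξ)⟫_ℂ) := by rw [hFG, hFW, hFWc]
  -- Step 2: expand the symbol pointwise
  have h2pi : (2 * Real.pi * I : ℂ) ≠ 0 := by simp [Real.pi_ne_zero, I_ne_zero]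
  have hdivW : ∀ ξ : E3, ∑ i, (ξ i : ℂ) * FW ξ i = 𝓕 (⇑ρW) ξ / (2 * Real.pi * I) := by
    intro ξ
    rw [hFWc, fourier_divSchwartz_apply cW ρW hρW ξ]
    field_simp
  have hdivG : ∀ ξ : E3, ∑ i, (ξ i : ℂ) * FG ξ i = 𝓕 (⇑ρG) ξ / (2 * Real.pi * I) := by
    intro ξ
    rw [hFGc, fourier_divSchwartz_apply cG ρG hρG ξ]
    field_simp
  set c : ℝ := ((2 * Real.pi) ^ 2)⁻¹ with hc
  have hpt : ∀ ξ : E3, ⟪FG ξ, leraySymbolC ξ (FW ξ)⟫_ℂ =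
      ⟪FG ξ, FW ξ⟫_ℂ - (c : ℂ) * (𝓕 (⇑ρW) ξ * conj (𝓕 (⇑ρG) ξ) / ((‖ξ‖ ^ 2 : ℝ) : ℂ)) := by
    intro ξ
    rw [inner_leraySymbolC_eq, hdivW, hdivG]
    have hconj : conj (𝓕 (⇑ρG) ξ / (2 * ↑Real.pi * I)) = conj (𝓕 (⇑ρG) ξ) / (-(2 * Real.pi * I)) := by
      rw [map_div₀]
      congr 1
      simp [conj_ofReal, conj_I, map_ofNat]
    rw [hconj, hc]
    push_cast
    field_simp
    ring_nf
    rw [I_sq]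
    ring
  -- Step 3: integrability and splitting
  obtain ⟨C, hC⟩ : ∃ C, ∀ ξ, ‖FG ξ‖ ≤ C := by
    obtain ⟨C, -, hC⟩ := FG.decay 0 0
    exact ⟨C, fun ξ => by simpa using hC ξ⟩
  have hI1 : Integrable (fun ξ : E3 => ⟪FG ξ, FW ξ⟫_ℂ) := by
    refine Integrable.mono' (FW.integrable.norm.const_mul C)
      (FG.continuous.inner FW.continuous).aestronglyMeasurable ?_
    refine Filter.Eventually.of_forall fun ξ => (norm_inner_le_norm _ _).trans ?_
    exact mul_le_mul_of_nonneg_right (hC ξ) (norm_nonneg _)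
  have hI : Integrable (fun ξ : E3 => ⟪FG ξ, leraySymbolC ξ (FW ξ)⟫_ℂ) := by
    have hPi' : Integrable (fun ξ => leraySymbolC ξ (FW ξ)) := by rw [hFWc, ← hFW]; exact hPi
    refine Integrable.mono' (hPi'.norm.const_mul C)
      (FG.continuous.aestronglyMeasurable.inner hPi'.aestronglyMeasurable) ?_
    refine Filter.Eventually.of_forall fun ξ => (norm_inner_le_norm _ _).trans ?_
    exact mul_le_mul_of_nonneg_right (hC ξ) (norm_nonneg _)
  have hI2 : Integrable (fun ξ : E3 =>
      (c : ℂ) * (𝓕 (⇑ρW) ξ * conj (𝓕 (⇑ρG) ξ) / ((‖ξ‖ ^ 2 : ℝ) : ℂ))) := by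
    refine (hI1.sub hI).congr (Filter.Eventually.of_forall fun ξ => ?_)
    simp only [Pi.sub_apply, hpt ξ]
    ring
  -- Step 4: Plancherel for the regular part
  have hplanch : RCLike.re (∫ ξ : E3, ⟪FG ξ, FW ξ⟫_ℂ) = ∫ x, ⟪W x, G x⟫ := by
    rw [hFGdef, hFWdef, SchwartzMap.integral_inner_fourier_fourier cG cW]
    have : ∀ x, ⟪cG x, cW x⟫_ℂ = ((⟪G x, W x⟫ : ℝ) : ℂ) := fun x => by
      rw [show cG x = FunctionSpaces.EuclideanSpace.complexify (G x) from rfl,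
        show cW x = FunctionSpaces.EuclideanSpace.complexify (W x) from rfl,
        FunctionSpaces.EuclideanSpace.inner_complexify]
    simp_rw [this]
    rw [integral_complex_ofReal]
    simp only [RCLike.re_to_complex, Complex.ofReal_re]
    exact integral_congr_ae (Filter.Eventually.of_forall fun x => real_inner_comm _ _)
  -- assemble
  rw [step1]
  have hsplit : ∫ ξ : E3, ⟪FG ξ, leraySymbolC ξ (FW ξ)⟫_ℂ =
      (∫ ξ : E3, ⟪FG ξ, FW ξ⟫_ℂ) -
        ∫ ξ : E3, (c : ℂ) * (𝓕 (⇑ρW) ξ * conj (𝓕 (⇑ρG) ξ) / ((‖ξ‖ ^ 2 : ℝ) : ℂ)) := by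
    rw [← integral_sub hI1 hI2]
    exact integral_congr_ae (Filter.Eventually.of_forall fun ξ => hpt ξ)
  rw [hsplit, map_sub, hplanch, integral_const_mul]
  congr 1
  simp only [RCLike.re_to_complex, Complex.re_ofReal_mul]

end Duality

/-! ### Integration by parts against the Euler bilinear term -/

section Parts
open FourierTransform Complex Literature.Analysis Literature.Analysis.FluidPDE

/-- `⟪f, g⟫` is integrable for `f g ∈ L²`. -/
theorem integrable_inner_of_memLp_two {f g : E3 → E3} (hf : MemLp f 2 volume) (hg : MemLp g 2 volume) :
    Integrable (fun x => ⟪f x, g x⟫) := by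
  have h2 : Integrable (fun x => (‖f x‖ ^ 2 + ‖g x‖ ^ 2) / 2) :=
    ((hf.integrable_norm_pow two_ne_zero).add (hg.integrable_norm_pow two_ne_zero)).div_const 2
  refine h2.mono' (hf.1.inner hg.1) (Filter.Eventually.of_forall fun x => ?_)
  refine (norm_inner_le_norm _ _).trans ?_
  nlinarith [sq_nonneg (‖f x‖ - ‖g x‖), norm_nonneg (f x), norm_nonneg (g x)]

/-- The Euler bilinear term of a Schwartz field is smooth with `b ∈ L²`, `Db ∈ L²`. -/
theorem eulerBilinear_regularity {v : E3 → E3} (hv : IsSchwartzField v) :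
    ContDiff ℝ (⊤ : ℕ∞) (eulerBilinear v v) ∧ MemLp (eulerBilinear v v) 2 volume ∧
      ∀ w : E3, MemLp (fun x => fderiv ℝ (eulerBilinear v v) x w) 2 volume := by
  obtain ⟨hsm, hL2⟩ := contDiff_eulerBilinear_holds (ι := Fin 3) hv hv
  refine ⟨hsm, ?_, fun w => ?_⟩
  · have h0 := hL2 0
    have he : (fun x => ‖iteratedFDeriv ℝ 0 (eulerBilinear v v) x‖) = fun x => ‖eulerBilinear v v x‖ :=
      funext fun x => norm_iteratedFDeriv_zero
    exact (memLp_norm_iff hsm.continuous.aestronglyMeasurable).1 (he ▸ h0.norm)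
  · have h1 := hL2 1
    have hcont : Continuous fun x => fderiv ℝ (eulerBilinear v v) x w :=
      (hsm.continuous_fderiv (by simp)).clm_apply continuous_const
    refine MemLp.mono' (h1.norm.const_mul ‖w‖) hcont.aestronglyMeasurable
      (Filter.Eventually.of_forall fun x => ?_)
    rw [← norm_iteratedFDeriv_fderiv, norm_iteratedFDeriv_zero, mul_comm]
    exact (fderiv ℝ (eulerBilinear v v) x).le_opNorm w

/-- **Integration by parts** of `∂ⱼ b` against a Schwartz test field, `b = B(v,v)` the Euler bilinear
term of a Schwartz field: `∫ ⟪∂ⱼ b, Ψ⟫ = -∫ ⟪b, ∂ⱼ Ψ⟫`. -/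
theorem integral_inner_fderiv_eulerBilinear {v : E3 → E3} (hv : IsSchwartzField v) (Ψ : 𝓢(E3, E3))
    (j : Fin 3) :
    ∫ x, ⟪fderiv ℝ (eulerBilinear v v) x (EuclideanSpace.single j (1 : ℝ)), Ψ x⟫ =
      -∫ x, ⟪eulerBilinear v v x, (∂_{EuclideanSpace.single j (1 : ℝ)} Ψ : 𝓢(E3, E3)) x⟫ := by
  obtain ⟨hsm, hb2, hDb2⟩ := eulerBilinear_regularity hv
  set b := eulerBilinear v v with hb
  set e : E3 := EuclideanSpace.single j (1 : ℝ) with he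
  have hΨ' : ∀ x, (∂_{e} Ψ : 𝓢(E3, E3)) x = fderiv ℝ (⇑Ψ) x e := fun x =>
    SchwartzMap.lineDerivOp_apply_eq_fderiv e Ψ x
  have h := integral_bilinear_hasFDerivAt_right_eq_neg_left_of_integrable (μ := volume)
    (B := innerSL ℝ (E := E3)) (f := b) (f' := fun x => fderiv ℝ b x) (g := ⇑Ψ)
    (g' := fun x => fderiv ℝ (⇑Ψ) x) (v := e) ?_ ?_ ?_ (fun x _ => (hsm.differentiable (by simp) x).hasFDerivAt)
    (fun x _ => Ψ.differentiableAt.hasFDerivAt)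
  · have h' : ∫ x, ⟪b x, fderiv ℝ (⇑Ψ) x e⟫ = -∫ x, ⟪fderiv ℝ b x e, Ψ x⟫ := h
    simp_rw [hΨ']
    rw [h', neg_neg]
  · show Integrable (fun x => ⟪fderiv ℝ b x e, Ψ x⟫)
    exact integrable_inner_of_memLp_two (hDb2 e) (Ψ.memLp 2 volume)
  · show Integrable (fun x => ⟪b x, fderiv ℝ (⇑Ψ) x e⟫)
    have hm : MemLp (fun x => fderiv ℝ (⇑Ψ) x e) 2 volume := by
      have h2 := (∂_{e} Ψ : 𝓢(E3, E3)).memLp 2 volume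
      exact h2.ae_eq (Filter.Eventually.of_forall fun x => hΨ' x)
    exact integrable_inner_of_memLp_two hb2 hm
  · show Integrable (fun x => ⟪b x, Ψ x⟫)
    exact integrable_inner_of_memLp_two hb2 (Ψ.memLp 2 volume)

/-- A linear map on `ℝ³` applied to a vector, expanded along the standard basis. -/
theorem clm_apply_eq_sum3 (L : E3 →L[ℝ] E3) (w : E3) :
    L w = ∑ j : Fin 3, w j • L (EuclideanSpace.single j (1 : ℝ)) := by
  conv_lhs => rw [← (EuclideanSpace.basisFun (Fin 3) ℝ).sum_repr' w]
  simp [map_sum, map_smul, EuclideanSpace.inner_single_left]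

/-- **The pointwise identity** behind the order-3 computation: for any field `b` (think `b = B(v,v)`),
`⟪curl b, A ω⟫ + ⟪ω, (Db) ω⟫ + ⟪ω, A curl b⟫ = ∑ⱼ ⟪∂ⱼ b, Ψⱼ(A, ω)⟫` with `A = Dv(x)`, `ω = curl v (x)`. -/
theorem orderThree_integrand_eq (b v : E3 → E3) (x : E3) :
    ⟪curl b x, fderiv ℝ v x (curl v x)⟫ + ⟪curl v x, fderiv ℝ b x (curl v x)⟫ +
        ⟪curl v x, fderiv ℝ v x (curl b x)⟫ =
      ∑ j : Fin 3, ⟪fderiv ℝ b x (EuclideanSpace.single j (1 : ℝ)),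
        psiVec (fderiv ℝ v x) (curl v x) j⟫ := by
  set L := fderiv ℝ b x
  set A := fderiv ℝ v x
  set ω := curl v x
  have hcb : curl b x = WithLp.toLp 2 ![L (EuclideanSpace.single 1 1) 2 - L (EuclideanSpace.single 2 1) 1,
      L (EuclideanSpace.single 2 1) 0 - L (EuclideanSpace.single 0 1) 2,
      L (EuclideanSpace.single 0 1) 1 - L (EuclideanSpace.single 1 1) 0] := rfl
  rw [hcb, clm_apply_eq_sum3 L ω, clm_apply_eq_sum3 A ω, clm_apply_eq_sum3 A (WithLp.toLp 2 _)]
  simp only [psiVec, clm_apply_eq_sum3 A ω]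
  simp [PiLp.inner_apply, Fin.sum_univ_three, Matrix.cons_val]
  ring

/-- **Assembly**: for a Schwartz field `v`, `b = B(v,v)`, and Schwartz test fields `Ψⱼ` realising `Ψⱼ(Dv, curl v)`
pointwise, `-∫ (⟪curl b, (Dv) ω⟫ + ⟪ω, (Db) ω⟫ + ⟪ω, (Dv) curl b⟫) = ∫ ⟪b, ∑ⱼ ∂ⱼ Ψⱼ⟫`. -/
theorem orderThree_eq_integral_inner {v : E3 → E3} (hv : IsSchwartzField v) (Ψ : Fin 3 → 𝓢(E3, E3))
    (hΨ : ∀ j x, Ψ j x = psiVec (fderiv ℝ v x) (curl v x) j) :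
    -∫ x, (⟪curl (eulerBilinear v v) x, fderiv ℝ v x (curl v x)⟫ +
        ⟪curl v x, fderiv ℝ (eulerBilinear v v) x (curl v x)⟫ +
          ⟪curl v x, fderiv ℝ v x (curl (eulerBilinear v v) x)⟫) =
      ∫ x, ⟪eulerBilinear v v x, (∑ j, (∂_{EuclideanSpace.single j (1 : ℝ)} (Ψ j) : 𝓢(E3, E3))) x⟫ := by
  set b := eulerBilinear v v with hb
  obtain ⟨hsm, hb2, hDb2⟩ := eulerBilinear_regularity hv
  have hint : ∀ j, Integrable (fun x => ⟪fderiv ℝ b x (EuclideanSpace.single j (1 : ℝ)), Ψ j x⟫) := fun j =>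
    integrable_inner_of_memLp_two (hDb2 _) ((Ψ j).memLp 2 volume)
  have hint' : ∀ j, Integrable (fun x => ⟪b x, (∂_{EuclideanSpace.single j (1 : ℝ)} (Ψ j) : 𝓢(E3, E3)) x⟫) :=
    fun j => integrable_inner_of_memLp_two hb2 ((∂_{EuclideanSpace.single j (1 : ℝ)} (Ψ j) : 𝓢(E3, E3)).memLp 2 volume)
  calc -∫ x, (⟪curl b x, fderiv ℝ v x (curl v x)⟫ + ⟪curl v x, fderiv ℝ b x (curl v x)⟫ +
          ⟪curl v x, fderiv ℝ v x (curl b x)⟫)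
      = -∫ x, ∑ j : Fin 3, ⟪fderiv ℝ b x (EuclideanSpace.single j (1 : ℝ)), Ψ j x⟫ := by
        congr 1
        refine integral_congr_ae (Filter.Eventually.of_forall fun x => ?_)
        beta_reduce
        rw [orderThree_integrand_eq]
        exact Finset.sum_congr rfl fun j _ => by rw [hΨ j x]
    _ = -∑ j : Fin 3, ∫ x, ⟪fderiv ℝ b x (EuclideanSpace.single j (1 : ℝ)), Ψ j x⟫ := by
        rw [integral_finsetSum _ fun j _ => hint j]
    _ = ∑ j : Fin 3, ∫ x, ⟪b x, (∂_{EuclideanSpace.single j (1 : ℝ)} (Ψ j) : 𝓢(E3, E3)) x⟫ := by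
        rw [← Finset.sum_neg_distrib]
        refine Finset.sum_congr rfl fun j _ => ?_
        rw [integral_inner_fderiv_eulerBilinear hv (Ψ j) j, neg_neg]
    _ = ∫ x, ∑ j : Fin 3, ⟪b x, (∂_{EuclideanSpace.single j (1 : ℝ)} (Ψ j) : 𝓢(E3, E3)) x⟫ := by
        rw [integral_finsetSum _ fun j _ => hint' j]
    _ = ∫ x, ⟪b x, (∑ j, (∂_{EuclideanSpace.single j (1 : ℝ)} (Ψ j) : 𝓢(E3, E3))) x⟫ := by
        refine integral_congr_ae (Filter.Eventually.of_forall fun x => ?_)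
        beta_reduce
        rw [sum_apply, inner_sum]

/-- `∫ ⟪B(v,v), G⟫ = -½ ∫ ⟪P W, G⟫` when `W = 2 (v·∇)v` pointwise. -/
theorem integral_inner_eulerBilinear_eq {v : E3 → E3} (W G : 𝓢(E3, E3))
    (hW : ∀ x, W x = convect v v x + convect v v x) :
    ∫ x, ⟪eulerBilinear v v x, G x⟫ = -2⁻¹ * ∫ x, ⟪lerayProjFun (⇑W) x, G x⟫ := by
  have hWf : (fun x => convect v v x + convect v v x) = ⇑W := funext fun x => (hW x).symm
  have h1 : ∀ x, ⟪eulerBilinear v v x, G x⟫ = -2⁻¹ * ⟪lerayProjFun (⇑W) x, G x⟫ := by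
    intro x
    rw [eulerBilinear, hWf, Pi.smul_apply, real_inner_smul_left]
  simp_rw [h1]
  exact integral_const_mul _ _

end Parts
end Summit.NavierStokesRegularity.NavierStokesRegularity.Theorems.OddMorawetz
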